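import Mathlib
import Literature.Analysis.FluidPDE.Tao2016AveragedNS.ShiftSetCascadeFlows
import Literature.Analysis.FluidPDE.Tao2016AveragedNS.WeightedLatticeFlows
import Literature.Analysis.ODE.GlobalExistence
import Literature.Analysis.ODE.AutonomousContinuation
import Literature.Analysis.ODE.MaximalTime
import HarnessLib

/-!
# Tao 2016, §4 on a general shift set: the `𝕊`-lattice as an ODE in a weighted sup-norm Banach space

T. Tao, *Finite time blowup for an averaged three-dimensional Navier–Stokes equation*, J. Amer. Math. Soc. **29**
(2016) 601–674 = arXiv:1402.0290v3, §4 (4.8)/(4.12), with the shift set `S` replaced by a finite parameter `𝕊`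
(tree vocabulary `TaoCascade.quadTermOn`, `TaoCascade.PseudoFlowOnShift` of `ShiftSetCascadeFlows`). Wanted by the
cell harvest/h2-tao-ladder (route TaoLadderRungTwoFlat, crux K_A♭ = stmt-NavierStokesRegularity-22987): the
(exist₀) clause of a format-A♭ certificate `GapData₂On 𝕊` asks for EXACT flows of the two-way lattice `S♭` from
every state of a weighted ball, and this module is the existence theory that clause rests on.

The tree module `Literature…Tao2016AveragedNS.WeightedLatticeFlows` treats Tao's ONE-WAY shift set `S`: after
the change of variables `T_{i,k} = w_k X_{i,k}` the exact lattice `∂ₜX = quadTerm(X)` is a locally Lipschitz ODE on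
the Banach space `Fin m × ℤ →ᵇ ℝ` as soon as three gain/weight ratios are bounded. This file is the SAME theory
for the nonlinearity `quadTermOn 𝕊` of an ARBITRARY finite shift set `𝕊` (in particular the two-way `S♭` with
its three backscatter classes): the admissibility condition becomes ONE ratio per shift,
`(1+ε₀)^{5(k-μ₃)/2} · w_k / (w_{k-μ₃+μ₁} · w_{k-μ₃+μ₂}) ≤ A` for `μ ∈ 𝕊` (`WeightRatiosLEOn`), and every
estimate is a plain triple sum over `(i₁, i₂, μ)`:

* `weightedFieldFunOn` / `weightedFieldOn` — the conjugated field `T ↦ (w_k · quadTermOn_{i,k}(T/w))`, with the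
  coordinatewise Lipschitz bound `2 m² |𝕊| M_α A R ‖T − T'‖` on the ball `‖T‖ ≤ R`
  (`abs_weightedFieldFunOn_sub_le`), the quadratic bound `norm_weightedFieldOn_le` and
  `lipschitzOnWith_weightedFieldOn`;
* `exists_exact_pseudoFlowOnShift_of_apriori_bound` — CONTINUATION CRITERION: an a priori weighted bound for all
  conjugated solutions on sub-windows of `[0,c]` gives an EXACT flow of the `𝕊`-lattice on `[0,c]`
  (`PseudoFlowOnShift 𝕊 c ε₀ α 0 0 S₀ (½S₀²) 0 S (½S²)`, the (exist₀)/(front) clause shape of `GapData₂On 𝕊`),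
  provided `sup_k (1+(1+ε₀)^{10k})/w_k < ∞`;
* `weightedFieldOn_apriori_short` / `exists_exact_pseudoFlowOnShift_short` — unconditional SHORT-window existence
  by the maximal-time continuity argument, and `exists_exact_pseudoFlowOnShift_short_of_inTableClassOn` for
  tables of the class `E(𝕊, R)` (`|α| ≤ 1` everywhere, since such tables are supported on `𝕊`).

Standard ODE theory in Banach spaces (Picard–Lindelöf + continuation, tree modules
`Literature.Analysis.ODE.GlobalExistence` / `MaximalTime` / `AutonomousContinuation`; Teschl 2012 Thm 2.2,
Cor. 2.16) applied to Tao-type MODEL lattices; nothing is asserted about any particular table, no certificate is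
produced, and nothing here is a statement about the Navier–Stokes equations.
-/

noncomputable section

open Set Metric Filter BoundedContinuousFunction
open scoped NNReal Topology

namespace Literature.Analysis.FluidPDE

namespace TaoCascade

variable {m : ℕ} {𝕊 : Finset (ℤ × ℤ × ℤ)}

/-! ### Admissible weights for a shift set and the conjugated field -/

/-- **Admissible weight ratios for the shift set `𝕊`.** Positive weights `w` such that for every shell `k`
and every shift `μ = (μ₁,μ₂,μ₃) ∈ 𝕊` the gain/weight ratio of the conjugated term,
`(1+ε₀)^{5(k-μ₃)/2} · w_k / (w_{k-μ₃+μ₁} · w_{k-μ₃+μ₂})`, is at most `A`. (For Tao's `S` these are the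
three ratios of `TaoCascade.WeightRatiosLE`; for `S♭` the backscatter classes add
`(1+ε₀)^{5k/2} w_k/w_{k+1}²` and `(1+ε₀)^{5(k-1)/2}/w_{k-1}`.) [cite: Tao2016AveragedNS, §4 (4.8) (the gains); cell vocabulary, shift-set parametrised] -/
def WeightRatiosLEOn (𝕊 : Finset (ℤ × ℤ × ℤ)) (ε₀ : ℝ) (w : ℤ → ℝ) (A : ℝ) : Prop :=
  (∀ k : ℤ, 0 < w k) ∧ ∀ (k : ℤ) (μ : ℤ × ℤ × ℤ), μ ∈ 𝕊 →
    (1 + ε₀) ^ ((5 : ℝ) * (k - μ.2.2) / 2) * w k / (w (k - μ.2.2 + μ.1) * w (k - μ.2.2 + μ.2.1)) ≤ A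

/-- The components of the CONJUGATED `𝕊`-lattice field in the weighted variables `T_{i,k} = w_k X_{i,k}`:
`(i,k) ↦ w_k · quadTermOn_{i,k}(T/w)`. [cite: Tao2016AveragedNS, §4 (4.8), (4.12); cell vocabulary, shift-set parametrised] -/
def weightedFieldFunOn (𝕊 : Finset (ℤ × ℤ × ℤ)) (ε₀ : ℝ) (α : Fin m → Fin m → Fin m → ℤ × ℤ × ℤ → ℝ)
    (w : ℤ → ℝ) (T : Fin m × ℤ →ᵇ ℝ) : Fin m × ℤ → ℝ :=
  fun p => w p.2 * quadTermOn 𝕊 ε₀ α (fun j n (_ : ℝ) => T (j, n) / w n) p.1 p.2 0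

/-- Coordinates of a bounded function are bounded by its norm, in weighted form. [folklore] -/
private theorem abs_apply_div_le_of_norm_le {w : ℤ → ℝ} (hw : ∀ k, 0 < w k) {T : Fin m × ℤ →ᵇ ℝ} {R : ℝ}
    (hT : ‖T‖ ≤ R) (j : Fin m) (n : ℤ) : |T (j, n) / w n| ≤ R / w n := by
  rw [abs_div, abs_of_pos (hw n)]
  exact div_le_div_of_nonneg_right ((Real.norm_eq_abs _ ▸ T.norm_coe_le_norm (j, n)).trans hT)
    (hw n).le

/-- Differences of weighted coordinates are bounded by the distance. [folklore] -/
private theorem abs_apply_div_sub_le_norm {w : ℤ → ℝ} (hw : ∀ k, 0 < w k) (T T' : Fin m × ℤ →ᵇ ℝ)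
    (j : Fin m) (n : ℤ) : |T (j, n) / w n - T' (j, n) / w n| ≤ ‖T - T'‖ / w n := by
  rw [← sub_div, abs_div, abs_of_pos (hw n), ← BoundedContinuousFunction.sub_apply]
  exact div_le_div_of_nonneg_right (Real.norm_eq_abs _ ▸ (T - T').norm_coe_le_norm (j, n)) (hw n).le

/-- One bilinear term: `|a b − a' b'| ≤ R_a d_b + d_a R_b` from `|a| ≤ R_a`, `|b'| ≤ R_b`, `|a − a'| ≤ d_a`,
`|b − b'| ≤ d_b`. [folklore] -/
private theorem abs_mul_sub_mul_le {a b a' b' Ra Rb da db : ℝ} (ha : |a| ≤ Ra) (hb' : |b'| ≤ Rb)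
    (hda : |a - a'| ≤ da) (hdb : |b - b'| ≤ db) : |a * b - a' * b'| ≤ Ra * db + da * Rb := by
  have h1 : a * b - a' * b' = a * (b - b') + (a - a') * b' := by ring
  rw [h1]
  calc |a * (b - b') + (a - a') * b'| ≤ |a * (b - b')| + |(a - a') * b'| := abs_add_le _ _
    _ = |a| * |b - b'| + |a - a'| * |b'| := by rw [abs_mul, abs_mul]
    _ ≤ Ra * db + da * Rb := by
        have hda0 : 0 ≤ da := (abs_nonneg _).trans hda
        have hRa0 : 0 ≤ Ra := (abs_nonneg _).trans ha
        gcongr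

/-- **The conjugated field is Lipschitz on balls, coordinatewise**: for `‖T‖, ‖T'‖ ≤ R`,
`|F(T)_{i,k} − F(T')_{i,k}| ≤ 2 m² |𝕊| M_α A R ‖T − T'‖`. [cite: Tao2016AveragedNS, §4 (4.8); folklore estimate] -/
theorem abs_weightedFieldFunOn_sub_le {ε₀ A Mα R : ℝ} {α : Fin m → Fin m → Fin m → ℤ × ℤ × ℤ → ℝ}
    {w : ℤ → ℝ} (hε : 0 ≤ 1 + ε₀) (hw : WeightRatiosLEOn 𝕊 ε₀ w A) (hMα : 0 ≤ Mα)
    (hα : ∀ i₁ i₂ i₃ μ, |α i₁ i₂ i₃ μ| ≤ Mα) (hR : 0 ≤ R) {T T' : Fin m × ℤ →ᵇ ℝ}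
    (hT : ‖T‖ ≤ R) (hT' : ‖T'‖ ≤ R) (i : Fin m) (k : ℤ) :
    |weightedFieldFunOn 𝕊 ε₀ α w T (i, k) - weightedFieldFunOn 𝕊 ε₀ α w T' (i, k)| ≤
      2 * (m : ℝ) ^ 2 * 𝕊.card * Mα * A * R * ‖T - T'‖ := by
  obtain ⟨hwpos, hrat⟩ := hw
  set d : ℝ := ‖T - T'‖ with hd
  have hd0 : 0 ≤ d := norm_nonneg _
  have hS : ∀ j n, |T (j, n) / w n| ≤ R / w n := abs_apply_div_le_of_norm_le hwpos hT
  have hS' : ∀ j n, |T' (j, n) / w n| ≤ R / w n := abs_apply_div_le_of_norm_le hwpos hT'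
  have hdS : ∀ j n, |T (j, n) / w n - T' (j, n) / w n| ≤ d / w n :=
    abs_apply_div_sub_le_norm hwpos T T'
  have hwk : 0 < w k := hwpos k
  -- the difference as one triple sum
  have hdiff : weightedFieldFunOn 𝕊 ε₀ α w T (i, k) - weightedFieldFunOn 𝕊 ε₀ α w T' (i, k) =
      ∑ i₁ : Fin m, ∑ i₂ : Fin m, ∑ μ ∈ 𝕊,
        w k * (α i₁ i₂ i μ * (1 + ε₀) ^ ((5 : ℝ) * (k - μ.2.2) / 2) *
          (T (i₁, k - μ.2.2 + μ.1) / w (k - μ.2.2 + μ.1) * (T (i₂, k - μ.2.2 + μ.2.1) / w (k - μ.2.2 + μ.2.1)) -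
           T' (i₁, k - μ.2.2 + μ.1) / w (k - μ.2.2 + μ.1) *
            (T' (i₂, k - μ.2.2 + μ.2.1) / w (k - μ.2.2 + μ.2.1)))) := by
    simp only [weightedFieldFunOn, quadTermOn, Finset.mul_sum, ← Finset.sum_sub_distrib]
    refine Finset.sum_congr rfl fun i₁ _ => Finset.sum_congr rfl fun i₂ _ =>
      Finset.sum_congr rfl fun μ _ => ?_
    ring
  -- termwise bound
  have hterm : ∀ (i₁ i₂ : Fin m) (μ : ℤ × ℤ × ℤ), μ ∈ 𝕊 →
      |w k * (α i₁ i₂ i μ * (1 + ε₀) ^ ((5 : ℝ) * (k - μ.2.2) / 2) *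
          (T (i₁, k - μ.2.2 + μ.1) / w (k - μ.2.2 + μ.1) * (T (i₂, k - μ.2.2 + μ.2.1) / w (k - μ.2.2 + μ.2.1)) -
           T' (i₁, k - μ.2.2 + μ.1) / w (k - μ.2.2 + μ.1) *
            (T' (i₂, k - μ.2.2 + μ.2.1) / w (k - μ.2.2 + μ.2.1))))| ≤ Mα * A * (2 * R * d) := by
    intro i₁ i₂ μ hμ
    set n₁ : ℤ := k - μ.2.2 + μ.1 with hn₁
    set n₂ : ℤ := k - μ.2.2 + μ.2.1 with hn₂
    set L : ℝ := (1 + ε₀) ^ ((5 : ℝ) * (k - μ.2.2) / 2) with hL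
    have hL0 : 0 ≤ L := Real.rpow_nonneg hε _
    have hw₁ : 0 < w n₁ := hwpos n₁
    have hw₂ : 0 < w n₂ := hwpos n₂
    have hprod := abs_mul_sub_mul_le (hS i₁ n₁) (hS' i₂ n₂) (hdS i₁ n₁) (hdS i₂ n₂)
    have hratio : L * w k / (w n₁ * w n₂) ≤ A := hrat k μ hμ
    have h2 : R / w n₁ * (d / w n₂) + d / w n₁ * (R / w n₂) = 2 * R * d / (w n₁ * w n₂) := by
      field_simp
      ring
    rw [h2] at hprod
    calc |w k * (α i₁ i₂ i μ * L *
            (T (i₁, n₁) / w n₁ * (T (i₂, n₂) / w n₂) - T' (i₁, n₁) / w n₁ * (T' (i₂, n₂) / w n₂)))|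
        = w k * (|α i₁ i₂ i μ| * L *
            |T (i₁, n₁) / w n₁ * (T (i₂, n₂) / w n₂) - T' (i₁, n₁) / w n₁ * (T' (i₂, n₂) / w n₂)|) := by
          rw [abs_mul, abs_of_pos hwk, abs_mul, abs_mul, abs_of_nonneg hL0]
      _ ≤ w k * (Mα * L * (2 * R * d / (w n₁ * w n₂))) := by
          refine mul_le_mul_of_nonneg_left ?_ hwk.le
          exact mul_le_mul (mul_le_mul_of_nonneg_right (hα i₁ i₂ i μ) hL0) hprod (abs_nonneg _)
            (mul_nonneg hMα hL0)
      _ = Mα * (L * w k / (w n₁ * w n₂)) * (2 * R * d) := by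
          field_simp
      _ ≤ Mα * A * (2 * R * d) := by
          have h3 : 0 ≤ 2 * R * d := by positivity
          exact mul_le_mul_of_nonneg_right (mul_le_mul_of_nonneg_left hratio hMα) h3
  rw [hdiff]
  calc |∑ i₁ : Fin m, ∑ i₂ : Fin m, ∑ μ ∈ 𝕊, w k * (α i₁ i₂ i μ * (1 + ε₀) ^ ((5 : ℝ) * (k - μ.2.2) / 2) *
          (T (i₁, k - μ.2.2 + μ.1) / w (k - μ.2.2 + μ.1) * (T (i₂, k - μ.2.2 + μ.2.1) / w (k - μ.2.2 + μ.2.1)) -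
           T' (i₁, k - μ.2.2 + μ.1) / w (k - μ.2.2 + μ.1) *
            (T' (i₂, k - μ.2.2 + μ.2.1) / w (k - μ.2.2 + μ.2.1))))|
      ≤ ∑ i₁ : Fin m, ∑ i₂ : Fin m, ∑ μ ∈ 𝕊, |w k * (α i₁ i₂ i μ * (1 + ε₀) ^ ((5 : ℝ) * (k - μ.2.2) / 2) *
          (T (i₁, k - μ.2.2 + μ.1) / w (k - μ.2.2 + μ.1) * (T (i₂, k - μ.2.2 + μ.2.1) / w (k - μ.2.2 + μ.2.1)) -
           T' (i₁, k - μ.2.2 + μ.1) / w (k - μ.2.2 + μ.1) *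
            (T' (i₂, k - μ.2.2 + μ.2.1) / w (k - μ.2.2 + μ.2.1))))| := by
        refine (Finset.abs_sum_le_sum_abs _ _).trans (Finset.sum_le_sum fun i₁ _ => ?_)
        refine (Finset.abs_sum_le_sum_abs _ _).trans (Finset.sum_le_sum fun i₂ _ => ?_)
        exact Finset.abs_sum_le_sum_abs _ _
    _ ≤ ∑ _i₁ : Fin m, ∑ _i₂ : Fin m, ∑ _μ ∈ 𝕊, Mα * A * (2 * R * d) :=
        Finset.sum_le_sum fun i₁ _ => Finset.sum_le_sum fun i₂ _ => Finset.sum_le_sum fun μ hμ =>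
          hterm i₁ i₂ μ hμ
    _ = 2 * (m : ℝ) ^ 2 * 𝕊.card * Mα * A * R * d := by
        simp only [Finset.sum_const, Finset.card_univ, Fintype.card_fin, nsmul_eq_mul]
        ring

/-- The conjugated field vanishes at the zero state. [folklore] -/
private theorem weightedFieldFunOn_zero (ε₀ : ℝ) (α : Fin m → Fin m → Fin m → ℤ × ℤ × ℤ → ℝ) (w : ℤ → ℝ)
    (p : Fin m × ℤ) : weightedFieldFunOn 𝕊 ε₀ α w 0 p = 0 := by
  obtain ⟨i, k⟩ := p
  simp [weightedFieldFunOn, quadTermOn]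

/-- **Quadratic bound on the conjugated field**, coordinatewise: `|F(T)_{i,k}| ≤ 2 m² |𝕊| M_α A ‖T‖²`.
[cite: Tao2016AveragedNS, §4 (4.8); folklore estimate] -/
theorem abs_weightedFieldFunOn_le {ε₀ A Mα : ℝ} {α : Fin m → Fin m → Fin m → ℤ × ℤ × ℤ → ℝ}
    {w : ℤ → ℝ} (hε : 0 ≤ 1 + ε₀) (hw : WeightRatiosLEOn 𝕊 ε₀ w A) (hMα : 0 ≤ Mα)
    (hα : ∀ i₁ i₂ i₃ μ, |α i₁ i₂ i₃ μ| ≤ Mα) (T : Fin m × ℤ →ᵇ ℝ) (p : Fin m × ℤ) :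
    |weightedFieldFunOn 𝕊 ε₀ α w T p| ≤ 2 * (m : ℝ) ^ 2 * 𝕊.card * Mα * A * ‖T‖ * ‖T‖ := by
  obtain ⟨i, k⟩ := p
  have h := abs_weightedFieldFunOn_sub_le hε hw hMα hα (norm_nonneg T) (T := T) (T' := 0) le_rfl
    (by simp) i k
  rwa [weightedFieldFunOn_zero, sub_zero, sub_zero] at h

/-- Admissible weight ratios on a nonempty shift set force `A ≥ 0`; on the empty shift set the field vanishes,
so in either case the products `… * A * ‖T‖²` bound a nonnegative quantity; we record the convenient form
`0 ≤ 2 m² |𝕊| M_α A` under `0 ≤ A`. [folklore] -/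
private theorem weightConst_nonneg {A Mα : ℝ} (hMα : 0 ≤ Mα) (hA : 0 ≤ A) :
    0 ≤ 2 * (m : ℝ) ^ 2 * (𝕊.card : ℝ) * Mα * A := by positivity

/-- **The conjugated `𝕊`-lattice field as a vector field on the Banach space `Fin m × ℤ →ᵇ ℝ`** (sup norm):
`T ↦ (w_k · quadTermOn_{i,k}(T/w))_{(i,k)}`, well defined (bounded output) for admissible weights and bounded
structure constants. [cite: Tao2016AveragedNS, §4 (4.8), (4.12); cell vocabulary, shift-set parametrised] -/
def weightedFieldOn {ε₀ A Mα : ℝ} {α : Fin m → Fin m → Fin m → ℤ × ℤ × ℤ → ℝ} {w : ℤ → ℝ}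
    (hε : 0 ≤ 1 + ε₀) (hw : WeightRatiosLEOn 𝕊 ε₀ w A) (hMα : 0 ≤ Mα)
    (hα : ∀ i₁ i₂ i₃ μ, |α i₁ i₂ i₃ μ| ≤ Mα) :
    (Fin m × ℤ →ᵇ ℝ) → (Fin m × ℤ →ᵇ ℝ) :=
  fun T => ofNormedAddCommGroupDiscrete (weightedFieldFunOn 𝕊 ε₀ α w T)
    (2 * (m : ℝ) ^ 2 * 𝕊.card * Mα * A * ‖T‖ * ‖T‖)
    fun p => (Real.norm_eq_abs _).trans_le (abs_weightedFieldFunOn_le hε hw hMα hα T p)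

/-- Components of the conjugated field. [cite: Tao2016AveragedNS, §4 (4.8); cell vocabulary, shift-set parametrised] -/
theorem weightedFieldOn_apply {ε₀ A Mα : ℝ} {α : Fin m → Fin m → Fin m → ℤ × ℤ × ℤ → ℝ} {w : ℤ → ℝ}
    (hε : 0 ≤ 1 + ε₀) (hw : WeightRatiosLEOn 𝕊 ε₀ w A) (hMα : 0 ≤ Mα)
    (hα : ∀ i₁ i₂ i₃ μ, |α i₁ i₂ i₃ μ| ≤ Mα) (T : Fin m × ℤ →ᵇ ℝ) (i : Fin m) (k : ℤ) :
    weightedFieldOn hε hw hMα hα T (i, k) =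
      w k * quadTermOn 𝕊 ε₀ α (fun j n (_ : ℝ) => T (j, n) / w n) i k 0 := rfl

/-- Norm bound of the conjugated field: `‖F(T)‖ ≤ 2 m² |𝕊| M_α A ‖T‖²`, for `A ≥ 0`.
[cite: Tao2016AveragedNS, §4 (4.8); estimate in cell vocabulary] -/
theorem norm_weightedFieldOn_le {ε₀ A Mα : ℝ} {α : Fin m → Fin m → Fin m → ℤ × ℤ × ℤ → ℝ} {w : ℤ → ℝ}
    (hε : 0 ≤ 1 + ε₀) (hw : WeightRatiosLEOn 𝕊 ε₀ w A) (hMα : 0 ≤ Mα)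
    (hα : ∀ i₁ i₂ i₃ μ, |α i₁ i₂ i₃ μ| ≤ Mα) (hA : 0 ≤ A) (T : Fin m × ℤ →ᵇ ℝ) :
    ‖weightedFieldOn hε hw hMα hα T‖ ≤ 2 * (m : ℝ) ^ 2 * 𝕊.card * Mα * A * ‖T‖ * ‖T‖ :=
  (norm_le (by have := weightConst_nonneg (m := m) (𝕊 := 𝕊) hMα hA; positivity)).2 fun p =>
    (Real.norm_eq_abs _).trans_le (abs_weightedFieldFunOn_le hε hw hMα hα T p)

/-- **The conjugated field is Lipschitz on every ball** `‖T‖ ≤ R` of the weighted sup-norm space, with constant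
`2 m² |𝕊| M_α A R`, for `A ≥ 0`. [cite: Tao2016AveragedNS, §4 (4.8); estimate in cell vocabulary] -/
theorem lipschitzOnWith_weightedFieldOn {ε₀ A Mα R : ℝ} {α : Fin m → Fin m → Fin m → ℤ × ℤ × ℤ → ℝ}
    {w : ℤ → ℝ} (hε : 0 ≤ 1 + ε₀) (hw : WeightRatiosLEOn 𝕊 ε₀ w A) (hMα : 0 ≤ Mα)
    (hα : ∀ i₁ i₂ i₃ μ, |α i₁ i₂ i₃ μ| ≤ Mα) (hA : 0 ≤ A) (hR : 0 ≤ R) :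
    LipschitzOnWith (Real.toNNReal (2 * (m : ℝ) ^ 2 * 𝕊.card * Mα * A * R)) (weightedFieldOn hε hw hMα hα)
      (closedBall 0 R) := by
  refine LipschitzOnWith.of_dist_le_mul fun T hT T' hT' => ?_
  rw [mem_closedBall, dist_zero_right] at hT hT'
  have hK : 0 ≤ 2 * (m : ℝ) ^ 2 * 𝕊.card * Mα * A * R := by
    have := weightConst_nonneg (m := m) (𝕊 := 𝕊) hMα hA; positivity
  rw [Real.coe_toNNReal _ hK]
  refine (dist_le (by positivity)).2 fun p => ?_
  obtain ⟨i, k⟩ := p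
  rw [Real.dist_eq, dist_eq_norm]
  exact abs_weightedFieldFunOn_sub_le hε hw hMα hα hR hT hT' i k

/-- `C¹` on a compact interval from a derivative within it that is continuous there. [folklore] -/
private theorem contDiffOn_one_Icc_of_hasDerivWithinAt' {f f' : ℝ → ℝ} {a b : ℝ} (hab : a < b)
    (hf : ∀ t ∈ Icc a b, HasDerivWithinAt f (f' t) (Icc a b) t) (hf' : ContinuousOn f' (Icc a b)) :
    ContDiffOn ℝ 1 f (Icc a b) := by
  rw [show (1 : WithTop ℕ∞) = 0 + 1 from (zero_add 1).symm,
    contDiffOn_succ_iff_derivWithin (uniqueDiffOn_Icc hab)]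
  refine ⟨fun t ht => (hf t ht).differentiableWithinAt, fun h => absurd h (by simp), ?_⟩
  exact contDiffOn_zero.2
    (hf'.congr fun t ht => (hf t ht).derivWithin (uniqueDiffOn_Icc hab t ht))

/-! ### Exact flows from an a priori weighted bound -/

/-- **CONTINUATION CRITERION ⇒ EXACT `𝕊`-LATTICE FLOW ON THE WHOLE WINDOW.** Let the weights be admissible for
`𝕊` (`A ≥ 0`) with `(1 + (1+ε₀)^{10k})/w_k ≤ D`, the structure constants bounded by `M_α`, `0 < c`, and let
`T₀ = w·S₀` with `‖T₀‖ ≤ B`. If every solution of the conjugated equation `T' = F(T)` from `T₀` on any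
`[0,s] ⊆ [0,c]` stays in the ball `‖T‖ ≤ B` (a priori bound — a HYPOTHESIS), then the `𝕊`-lattice admits an
EXACT flow on `[0,c]` from `S₀`: a `PseudoFlowOnShift 𝕊 c ε₀ α 0 0 S₀ (½S₀²) 0 S (½S²)` (zero defects, zero
slack, energies `½S²`), with `w_k |S_{i,k}(s)| ≤ B` throughout. Picard–Lindelöf + continuation in
`Fin m × ℤ →ᵇ ℝ` (tree: `Literature.Analysis.ODE.solution_extend`).
[cite: Tao2016AveragedNS, §4 Lemma 4.1 (4.5), (4.8)–(4.10), (4.12); Teschl2012, Cor. 2.16] -/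
theorem exists_exact_pseudoFlowOnShift_of_apriori_bound {ε₀ A Mα D B c : ℝ}
    {α : Fin m → Fin m → Fin m → ℤ × ℤ × ℤ → ℝ} {w : ℤ → ℝ}
    (hε : 0 ≤ 1 + ε₀) (hw : WeightRatiosLEOn 𝕊 ε₀ w A) (hMα : 0 ≤ Mα)
    (hα : ∀ i₁ i₂ i₃ μ, |α i₁ i₂ i₃ μ| ≤ Mα) (hA : 0 ≤ A)
    (hD : ∀ k : ℤ, (1 + (1 + ε₀) ^ ((10 : ℝ) * k)) / w k ≤ D) (hc : 0 < c)
    (S₀ : Fin m → ℤ → ℝ) (T₀ : Fin m × ℤ →ᵇ ℝ) (hT₀ : ∀ i k, T₀ (i, k) = w k * S₀ i k)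
    (hB : ‖T₀‖ ≤ B)
    (hapriori : ∀ s ∈ Icc 0 c, ∀ T : ℝ → (Fin m × ℤ →ᵇ ℝ), T 0 = T₀ →
      (∀ t ∈ Icc 0 s, HasDerivWithinAt T (weightedFieldOn hε hw hMα hα (T t)) (Icc 0 s) t) →
        ∀ t ∈ Icc 0 s, ‖T t‖ ≤ B) :
    ∃ S : Fin m → ℤ → ℝ → ℝ,
      PseudoFlowOnShift 𝕊 c ε₀ α 0 0 S₀ (fun i k => (1 / 2) * S₀ i k ^ 2) (fun _ _ => 0) S
        (fun i k s => (1 / 2) * S i k s ^ 2) ∧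
      ∀ s ∈ Icc 0 c, ∀ i k, w k * |S i k s| ≤ B := by
  obtain ⟨hwpos, hrat⟩ := hw
  have hB0 : 0 ≤ B := (norm_nonneg _).trans hB
  set F := weightedFieldOn hε ⟨hwpos, hrat⟩ hMα hα with hF
  have hK0 : 0 ≤ 2 * (m : ℝ) ^ 2 * (𝕊.card : ℝ) * Mα * A := weightConst_nonneg hMα hA
  -- Lipschitz and boundedness data on the ball of radius `B + 1`
  have hlip : ∀ t ∈ Icc (0 : ℝ) c,
      LipschitzOnWith (Real.toNNReal (2 * (m : ℝ) ^ 2 * 𝕊.card * Mα * A * (B + 1)))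
      ((fun (_ : ℝ) (x : Fin m × ℤ →ᵇ ℝ) => F x) t) (closedBall 0 (B + 1)) :=
    fun _ _ => lipschitzOnWith_weightedFieldOn hε ⟨hwpos, hrat⟩ hMα hα hA (by linarith)
  have hbdd : ∀ t ∈ Icc (0 : ℝ) c, ∀ x ∈ closedBall (0 : Fin m × ℤ →ᵇ ℝ) (B + 1),
      ‖(fun (_ : ℝ) (x : Fin m × ℤ →ᵇ ℝ) => F x) t x‖ ≤
        ((⟨2 * (m : ℝ) ^ 2 * 𝕊.card * Mα * A * (B + 1) * (B + 1), by positivity⟩ : ℝ≥0) : ℝ) := by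
    intro t _ x hx
    rw [mem_closedBall, dist_zero_right] at hx
    refine (norm_weightedFieldOn_le hε ⟨hwpos, hrat⟩ hMα hα hA x).trans ?_
    show 2 * (m : ℝ) ^ 2 * 𝕊.card * Mα * A * ‖x‖ * ‖x‖ ≤
      2 * (m : ℝ) ^ 2 * 𝕊.card * Mα * A * (B + 1) * (B + 1)
    have h2 : ‖x‖ * ‖x‖ ≤ (B + 1) * (B + 1) :=
      mul_le_mul hx hx (norm_nonneg _) (by linarith)
    nlinarith
  obtain ⟨T, hT, hT0⟩ := Literature.Analysis.ODE.solution_extend (v := fun _ x => F x) le_rfl hc.le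
    (Literature.Analysis.ODE.solution_const (fun _ x => F x) 0 T₀) (R := B) hlip
    (fun _ _ => continuousOn_const) hbdd
    (fun s hs β hβ hβα t ht => hapriori s ⟨hs.1, hs.2⟩ β (hβα (left_mem_Icc.2 le_rfl)) hβ t ht)
  have hT00 : T 0 = T₀ := hT0 (left_mem_Icc.2 le_rfl)
  -- the weighted bound along the solution
  have hTB : ∀ s ∈ Icc 0 c, ‖T s‖ ≤ B := hapriori c ⟨hc.le, le_rfl⟩ T hT00 hT
  -- the unweighted family
  refine ⟨fun i k s => T s (i, k) / w k, ?_, fun s hs i k => ?_⟩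
  swap
  · rw [abs_div, abs_of_pos (hwpos k), mul_div_cancel₀ _ (hwpos k).ne']
    exact ((Real.norm_eq_abs _).symm.le.trans ((T s).norm_coe_le_norm (i, k))).trans (hTB s hs)
  -- coordinates: derivative within `[0,c]`
  have hcoord : ∀ (i : Fin m) (k : ℤ), ∀ s ∈ Icc 0 c,
      HasDerivWithinAt (fun t => T t (i, k) / w k)
        (quadTermOn 𝕊 ε₀ α (fun j n (_ : ℝ) => T s (j, n) / w n) i k 0) (Icc 0 c) s := by
    intro i k s hs
    have h0 := ((BoundedContinuousFunction.evalCLM ℝ (i, k) :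
        (Fin m × ℤ →ᵇ ℝ) →L[ℝ] ℝ).hasFDerivAt).comp_hasDerivWithinAt s (hT s hs)
    have h1 : HasDerivWithinAt (fun t => T t (i, k)) (F (T s) (i, k)) (Icc 0 c) s := by
      simpa [Function.comp_def] using h0
    have h2 := h1.div_const (w k)
    rw [hF, weightedFieldOn_apply, mul_div_cancel_left₀ _ (hwpos k).ne'] at h2
    exact h2
  -- continuity of the right-hand side along the solution
  have hTcont : ContinuousOn T (Icc 0 c) := fun s hs => (hT s hs).continuousWithinAt
  have hrhs_cont : ∀ (i : Fin m) (k : ℤ),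
      ContinuousOn (fun s => quadTermOn 𝕊 ε₀ α (fun j n (_ : ℝ) => T s (j, n) / w n) i k 0) (Icc 0 c) := by
    intro i k
    have hc' : ∀ (j : Fin m) (n : ℤ), ContinuousOn (fun s => T s (j, n) / w n) (Icc 0 c) :=
      fun j n => (((BoundedContinuousFunction.evalCLM ℝ (j, n) :
        (Fin m × ℤ →ᵇ ℝ) →L[ℝ] ℝ).continuous).comp_continuousOn hTcont).div_const _
    simp only [quadTermOn]
    refine continuousOn_finsetSum _ fun i₁ _ => continuousOn_finsetSum _ fun i₂ _ =>
      continuousOn_finsetSum _ fun μ _ => ?_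
    exact (continuousOn_const.mul ((hc' _ _).mul (hc' _ _)))
  refine
    { contDiffOn_S := fun i k => contDiffOn_one_Icc_of_hasDerivWithinAt' hc (hcoord i k) (hrhs_cont i k)
      contDiffOn_F := fun i k => ?_
      nonneg_F := fun i k s _ => by positivity
      apriori_S := ⟨D * B, fun s hs i k => ?_⟩
      apriori_F := ⟨D * B, fun s hs i k => ?_⟩
      init_S := fun i k => by
        show T 0 (i, k) / w k = S₀ i k
        rw [hT00, hT₀, mul_div_cancel_left₀ _ (hwpos k).ne']
      init_F := fun i k => by
        show (1 / 2) * (T 0 (i, k) / w k) ^ 2 = (1 / 2) * S₀ i k ^ 2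
        rw [hT00, hT₀, mul_div_cancel_left₀ _ (hwpos k).ne']
      motion := fun i k s hs => by
        rw [(hcoord i k s hs).derivWithin (uniqueDiffOn_Icc hc s hs)]
        simp only [quadTermOn, sub_self, abs_zero, zero_mul, le_refl]
      energy := fun i k s hs => by
        have h := ((hcoord i k s hs).pow 2).const_mul (1 / 2 : ℝ)
        have h' : HasDerivWithinAt (fun t => (1 / 2) * (T t (i, k) / w k) ^ 2)
            (quadTermOn 𝕊 ε₀ α (fun j n (_ : ℝ) => T s (j, n) / w n) i k 0 * (T s (i, k) / w k))
            (Icc 0 c) s :=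
          h.congr_deriv (by rw [show (2 : ℕ) - 1 = 1 from rfl, pow_one, Nat.cast_ofNat]; ring)
        show derivWithin (fun t => (1 / 2) * (T t (i, k) / w k) ^ 2) (Icc 0 c) s ≤ _
        rw [h'.derivWithin (uniqueDiffOn_Icc hc s hs)]
        exact le_of_eq rfl
      defect_lower := fun i k s _ => le_rfl
      defect_upper := fun i k s _ => by simp }
  · -- `F = ½ S²` is `C¹`
    have h2 : ∀ s ∈ Icc 0 c, HasDerivWithinAt (fun t => (1 / 2) * (T t (i, k) / w k) ^ 2)
        ((1 / 2) * (↑(2 : ℕ) * (T s (i, k) / w k) ^ (2 - 1) *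
          quadTermOn 𝕊 ε₀ α (fun j n (_ : ℝ) => T s (j, n) / w n) i k 0)) (Icc 0 c) s :=
      fun s hs => ((hcoord i k s hs).pow 2).const_mul (1 / 2 : ℝ)
    refine contDiffOn_one_Icc_of_hasDerivWithinAt' hc h2 ?_
    have hc' : ContinuousOn (fun s => T s (i, k) / w k) (Icc 0 c) :=
      (((BoundedContinuousFunction.evalCLM ℝ (i, k) :
        (Fin m × ℤ →ᵇ ℝ) →L[ℝ] ℝ).continuous).comp_continuousOn hTcont).div_const _
    exact continuousOn_const.mul ((continuousOn_const.mul (hc'.pow _)).mul (hrhs_cont i k))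
  · -- a priori bound on the amplitudes
    have h1 : |T s (i, k) / w k| ≤ B / w k := by
      rw [abs_div, abs_of_pos (hwpos k)]
      exact div_le_div_of_nonneg_right
        (((Real.norm_eq_abs _).symm.le.trans ((T s).norm_coe_le_norm (i, k))).trans (hTB s hs))
        (hwpos k).le
    have hpow : 0 ≤ 1 + (1 + ε₀) ^ ((10 : ℝ) * k) := by positivity
    calc (1 + (1 + ε₀) ^ ((10 : ℝ) * k)) * |T s (i, k) / w k|
        ≤ (1 + (1 + ε₀) ^ ((10 : ℝ) * k)) * (B / w k) := mul_le_mul_of_nonneg_left h1 hpow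
      _ = (1 + (1 + ε₀) ^ ((10 : ℝ) * k)) / w k * B := by ring
      _ ≤ D * B := mul_le_mul_of_nonneg_right (hD k) hB0
  · -- a priori bound on the energies
    have h1 : |T s (i, k) / w k| ≤ B / w k := by
      rw [abs_div, abs_of_pos (hwpos k)]
      exact div_le_div_of_nonneg_right
        (((Real.norm_eq_abs _).symm.le.trans ((T s).norm_coe_le_norm (i, k))).trans (hTB s hs))
        (hwpos k).le
    have hpow : 0 ≤ 1 + (1 + ε₀) ^ ((10 : ℝ) * k) := by positivity
    have hsq : Real.sqrt ((1 / 2) * (T s (i, k) / w k) ^ 2) ≤ |T s (i, k) / w k| :=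
      calc Real.sqrt ((1 / 2 : ℝ) * (T s (i, k) / w k) ^ 2) ≤ Real.sqrt ((T s (i, k) / w k) ^ 2) :=
            Real.sqrt_le_sqrt (by nlinarith [sq_nonneg (T s (i, k) / w k)])
        _ = |T s (i, k) / w k| := Real.sqrt_sq_eq_abs _
    calc (1 + (1 + ε₀) ^ ((10 : ℝ) * k)) * Real.sqrt ((1 / 2) * (T s (i, k) / w k) ^ 2)
        ≤ (1 + (1 + ε₀) ^ ((10 : ℝ) * k)) * (B / w k) := mul_le_mul_of_nonneg_left (hsq.trans h1) hpow
      _ = (1 + (1 + ε₀) ^ ((10 : ℝ) * k)) / w k * B := by ring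
      _ ≤ D * B := mul_le_mul_of_nonneg_right (hD k) hB0

/-- **Short-time a priori bound** (continuity argument): if `‖T₀‖ ≤ B` and the window satisfies
`2 m² |𝕊| M_α A (2B+1)² · c ≤ B + 1/2` (`A ≥ 0`), every solution of the conjugated equation from `T₀` on any
`[0,s] ⊆ [0,c]` stays in the ball `‖T‖ ≤ 2B + 1` (bounded speed inside the ball, maximal-time exit principle).
[cite: Teschl2012, Thm 2.2 (Picard–Lindelöf, the a priori confinement step); folklore] -/
theorem weightedFieldOn_apriori_short {ε₀ A Mα B c : ℝ} {α : Fin m → Fin m → Fin m → ℤ × ℤ × ℤ → ℝ}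
    {w : ℤ → ℝ} (hε : 0 ≤ 1 + ε₀) (hw : WeightRatiosLEOn 𝕊 ε₀ w A) (hMα : 0 ≤ Mα)
    (hα : ∀ i₁ i₂ i₃ μ, |α i₁ i₂ i₃ μ| ≤ Mα) (hA : 0 ≤ A) {T₀ : Fin m × ℤ →ᵇ ℝ} (hB : ‖T₀‖ ≤ B)
    (hcL : 2 * (m : ℝ) ^ 2 * 𝕊.card * Mα * A * (2 * B + 1) * (2 * B + 1) * c ≤ B + 1 / 2) :
    ∀ s ∈ Icc 0 c, ∀ T : ℝ → (Fin m × ℤ →ᵇ ℝ), T 0 = T₀ →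
      (∀ t ∈ Icc 0 s, HasDerivWithinAt T (weightedFieldOn hε hw hMα hα (T t)) (Icc 0 s) t) →
        ∀ t ∈ Icc 0 s, ‖T t‖ ≤ 2 * B + 1 := by
  intro s hs T hT0 hT t ht
  have hB0 : 0 ≤ B := (norm_nonneg _).trans hB
  have hK0 : 0 ≤ 2 * (m : ℝ) ^ 2 * (𝕊.card : ℝ) * Mα * A := weightConst_nonneg hMα hA
  set R : ℝ := 2 * B + 1 with hR
  set L : ℝ := 2 * (m : ℝ) ^ 2 * 𝕊.card * Mα * A * R * R with hL
  have hL0 : 0 ≤ L := by positivity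
  have hcont : ContinuousOn T (Icc 0 s) := fun u hu => (hT u hu).continuousWithinAt
  have hP0 : ‖T 0‖ ≤ R := by rw [hT0]; linarith
  rcases eq_or_lt_of_le hs.1 with hs0 | hs0
  · -- degenerate window `s = 0`
    have ht0 : t = 0 := le_antisymm (hs0 ▸ ht.2) ht.1
    rw [ht0]
    exact hP0
  set τ := Literature.Analysis.ODE.maximalTimeP (fun u => ‖T u‖ ≤ R) 0 s with hτ
  have hclosed : ∀ u ∈ Ioc 0 s, (∀ v ∈ Ico 0 u, ‖T v‖ ≤ R) → ‖T u‖ ≤ R := by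
    intro u hu hprev
    have hcu : ContinuousWithinAt (fun v => ‖T v‖) (Ico 0 u) u :=
      ((hcont u ⟨hu.1.le, hu.2⟩).norm).mono fun v hv => ⟨hv.1, hv.2.le.trans hu.2⟩
    haveI : (𝓝[Ico 0 u] u).NeBot := by
      rw [← mem_closure_iff_nhdsWithin_neBot, closure_Ico hu.1.ne, right_mem_Icc]
      exact hu.1.le
    exact le_of_tendsto hcu (Filter.eventually_of_mem self_mem_nhdsWithin hprev)
  have hτmem : τ ∈ Icc 0 s := Literature.Analysis.ODE.maximalTimeP_mem hs0.le hP0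
  have hPτ : ∀ u ∈ Icc 0 τ, ‖T u‖ ≤ R := fun u hu =>
    Literature.Analysis.ODE.maximalTimeP_spec hs0.le hP0 hclosed hu
  -- improved bound on `[0, τ]` from the bounded speed
  have himp : ∀ u ∈ Icc 0 τ, ‖T u‖ ≤ R - 1 / 2 := by
    intro u hu
    have hsol : ∀ v ∈ Icc 0 τ, HasDerivWithinAt T (weightedFieldOn hε hw hMα hα (T v)) (Icc 0 τ) v :=
      fun v hv => (hT v ⟨hv.1, hv.2.trans hτmem.2⟩).mono (Icc_subset_Icc_right hτmem.2)
    have hspeed : ∀ v ∈ Icc 0 τ, ‖weightedFieldOn hε hw hMα hα (T v)‖ ≤ L := by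
      intro v hv
      refine (norm_weightedFieldOn_le hε hw hMα hα hA (T v)).trans ?_
      have h1 : ‖T v‖ ≤ R := hPτ v hv
      have h3 : ‖T v‖ * ‖T v‖ ≤ R * R := mul_le_mul h1 h1 (norm_nonneg _) (by linarith)
      rw [hL]
      nlinarith
    have hmv := Literature.Analysis.ODE.norm_sub_le_mul_of_hasDerivWithinAt (convex_Icc 0 τ) hsol
      hspeed (left_mem_Icc.2 hτmem.1) hu
    rw [sub_zero, abs_of_nonneg hu.1, hT0] at hmv
    have hu_c : u ≤ c := hu.2.trans (hτmem.2.trans hs.2)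
    have hLu : L * u ≤ B + 1 / 2 := by
      calc L * u ≤ L * c := mul_le_mul_of_nonneg_left hu_c hL0
        _ ≤ B + 1 / 2 := by rw [hL]; linarith
    calc ‖T u‖ = ‖(T u - T₀) + T₀‖ := by rw [sub_add_cancel]
      _ ≤ ‖T u - T₀‖ + ‖T₀‖ := norm_add_le _ _
      _ ≤ L * u + B := add_le_add hmv hB
      _ ≤ R - 1 / 2 := by linarith
  -- exit principle: `τ = s`
  have hτs : τ = s := by
    rcases Literature.Analysis.ODE.maximalTimeP_exit (P := fun u => ‖T u‖ ≤ R) hs0.le hP0 with h | h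
    · exact h
    · exfalso
      apply h
      have hcτ : ContinuousWithinAt (fun v => ‖T v‖) (Icc 0 s) τ := (hcont τ hτmem).norm
      have hlt : ‖T τ‖ < R := by linarith [himp τ ⟨hτmem.1, le_rfl⟩]
      exact (hcτ.eventually_mem (Iio_mem_nhds hlt)).mono fun v hv => le_of_lt hv
  exact hPτ t ⟨ht.1, ht.2.trans_eq hτs.symm⟩

/-- **LOCAL EXISTENCE OF EXACT `𝕊`-LATTICE FLOWS** (no dynamical hypothesis): for admissible weights (`A ≥ 0`)
with `(1 + (1+ε₀)^{10k})/w_k ≤ D`, bounded structure constants, and a weighted state `T₀ = w·S₀` with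
`‖T₀‖ ≤ B`, the `𝕊`-lattice has an EXACT flow `PseudoFlowOnShift 𝕊 c ε₀ α 0 0 S₀ (½S₀²) 0 S (½S²)` on every
window `0 < c` with `2 m² |𝕊| M_α A (2B+1)² · c ≤ B + 1/2`, obeying `w_k |S_{i,k}| ≤ 2B + 1` throughout.
[cite: Tao2016AveragedNS, §4 Lemma 4.1 (4.5), (4.8), (4.12); Teschl2012, Thm 2.2] -/
theorem exists_exact_pseudoFlowOnShift_short {ε₀ A Mα D B c : ℝ}
    {α : Fin m → Fin m → Fin m → ℤ × ℤ × ℤ → ℝ} {w : ℤ → ℝ}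
    (hε : 0 ≤ 1 + ε₀) (hw : WeightRatiosLEOn 𝕊 ε₀ w A) (hMα : 0 ≤ Mα)
    (hα : ∀ i₁ i₂ i₃ μ, |α i₁ i₂ i₃ μ| ≤ Mα) (hA : 0 ≤ A)
    (hD : ∀ k : ℤ, (1 + (1 + ε₀) ^ ((10 : ℝ) * k)) / w k ≤ D) (hc : 0 < c)
    (S₀ : Fin m → ℤ → ℝ) (T₀ : Fin m × ℤ →ᵇ ℝ) (hT₀ : ∀ i k, T₀ (i, k) = w k * S₀ i k)
    (hB : ‖T₀‖ ≤ B)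
    (hcL : 2 * (m : ℝ) ^ 2 * 𝕊.card * Mα * A * (2 * B + 1) * (2 * B + 1) * c ≤ B + 1 / 2) :
    ∃ S : Fin m → ℤ → ℝ → ℝ,
      PseudoFlowOnShift 𝕊 c ε₀ α 0 0 S₀ (fun i k => (1 / 2) * S₀ i k ^ 2) (fun _ _ => 0) S
        (fun i k s => (1 / 2) * S i k s ^ 2) ∧
      ∀ s ∈ Icc 0 c, ∀ i k, w k * |S i k s| ≤ 2 * B + 1 :=
  exists_exact_pseudoFlowOnShift_of_apriori_bound hε hw hMα hα hA hD hc S₀ T₀ hT₀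
    (hB.trans (by linarith [(norm_nonneg _).trans hB]))
    (weightedFieldOn_apriori_short hε hw hMα hα hA hB hcL)

/-! ### Tables of the class `E(𝕊, R)` -/

/-- Tables of the class `E(𝕊, R)` have structure constants of modulus `≤ 1` EVERYWHERE (`≤ 1` on `𝕊`, and
zero off `𝕊` by the support clause of `IsComparableCoeffOn`).
[cite: Tao2016AveragedNS, §6.1 (the table being compared); cell vocabulary, shift-set parametrised] -/
theorem abs_le_one_of_inTableClassOn {R : ℝ} {α : Fin m → Fin m → Fin m → ℤ × ℤ × ℤ → ℝ}
    (h : InTableClassOn 𝕊 R α) : ∀ i₁ i₂ i₃ μ, |α i₁ i₂ i₃ μ| ≤ 1 := by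
  intro i₁ i₂ i₃ μ
  by_cases hμ : μ ∈ 𝕊
  · exact (h.2.2.1 i₁ i₂ i₃ μ hμ).1
  · rw [h.2.2.2 i₁ i₂ i₃ μ hμ, abs_zero]
    exact zero_le_one

/-- **Local existence of exact `𝕊`-flows for a table of the class `E(𝕊, R)`**: the short-window statement
`exists_exact_pseudoFlowOnShift_short` with `M_α = 1`.
[cite: Tao2016AveragedNS, §4 Lemma 4.1 (4.5), (4.8), (4.12); Teschl2012, Thm 2.2] -/
theorem exists_exact_pseudoFlowOnShift_short_of_inTableClassOn {ε₀ A D B c R : ℝ}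
    {α : Fin m → Fin m → Fin m → ℤ × ℤ × ℤ → ℝ} {w : ℤ → ℝ}
    (hε : 0 ≤ 1 + ε₀) (hw : WeightRatiosLEOn 𝕊 ε₀ w A) (hA : 0 ≤ A) (hαR : InTableClassOn 𝕊 R α)
    (hD : ∀ k : ℤ, (1 + (1 + ε₀) ^ ((10 : ℝ) * k)) / w k ≤ D) (hc : 0 < c)
    (S₀ : Fin m → ℤ → ℝ) (T₀ : Fin m × ℤ →ᵇ ℝ) (hT₀ : ∀ i k, T₀ (i, k) = w k * S₀ i k)
    (hB : ‖T₀‖ ≤ B) (hcL : 2 * (m : ℝ) ^ 2 * 𝕊.card * 1 * A * (2 * B + 1) * (2 * B + 1) * c ≤ B + 1 / 2) :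
    ∃ S : Fin m → ℤ → ℝ → ℝ,
      PseudoFlowOnShift 𝕊 c ε₀ α 0 0 S₀ (fun i k => (1 / 2) * S₀ i k ^ 2) (fun _ _ => 0) S
        (fun i k s => (1 / 2) * S i k s ^ 2) ∧
      ∀ s ∈ Icc 0 c, ∀ i k, w k * |S i k s| ≤ 2 * B + 1 :=
  exists_exact_pseudoFlowOnShift_short hε hw zero_le_one (abs_le_one_of_inTableClassOn hαR) hA hD hc S₀ T₀
    hT₀ hB hcL

/-! ### From amplitudes to the weighted state -/

/-- **The weighted state of a family of amplitudes**: if `w_k |S₀_{i,k}| ≤ B` for all `(i,k)`, the function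
`(i,k) ↦ w_k S₀_{i,k}` is a point of the Banach space `Fin m × ℤ →ᵇ ℝ` of norm `≤ B` (so the existence theorems
above apply to every state of a weighted ball). [folklore] -/
private theorem exists_weightedState {w : ℤ → ℝ} {B : ℝ} (hB : 0 ≤ B) (S₀ : Fin m → ℤ → ℝ)
    (h : ∀ i k, w k * |S₀ i k| ≤ B) (hw : ∀ k, 0 < w k) :
    ∃ T₀ : Fin m × ℤ →ᵇ ℝ, (∀ i k, T₀ (i, k) = w k * S₀ i k) ∧ ‖T₀‖ ≤ B := by
  refine ⟨ofNormedAddCommGroupDiscrete (fun p : Fin m × ℤ => w p.2 * S₀ p.1 p.2) B fun p => ?_,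
    fun i k => rfl, ?_⟩
  · rw [Real.norm_eq_abs, abs_mul, abs_of_pos (hw p.2)]
    exact h p.1 p.2
  · exact (norm_le hB).2 fun p => by
      rw [Real.norm_eq_abs]
      show |w p.2 * S₀ p.1 p.2| ≤ B
      rw [abs_mul, abs_of_pos (hw p.2)]
      exact h p.1 p.2

end TaoCascade

end Literature.Analysis.FluidPDE

end
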